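import Mathlib.Combinatorics.SimpleGraph.Walk.Counting
import Mathlib.Combinatorics.SimpleGraph.Paths
import Mathlib.Combinatorics.SimpleGraph.Operations
import Mathlib.Topology.Algebra.InfiniteSum.ENNReal
import Summits.CriticalPhenomena.SAWScalingLimit.Theorems.SAWTotalPositivityBoundaryTP2Defs
import HarnessLib

/-!
# Crux `BoundaryTP2` (stmt-CriticalPhenomena-7115), line `Sketch`: the pendant consequence of
interlacing-only TP₂

`InterlacedTP2At x` (the interlacing-only strengthening of the crux's combinatorial core, see the `Defs`
module) has a cheap necessary consequence, a **three-point splitting inequality**: for a subgraph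
`H ≤ zdGraph 2` with finitely many non-isolated vertices and a vertex `w ∈ H.support` having two lattice
neighbours `q₁ ≠ q₂` that are isolated in `H`,

  `Z_H(w,p) · Z_H(w,q) ≤ Z_H(p,q)`  for all distinct `p, q ∈ H.support ∖ {w}`

(`stub_pendant_threePoint`, a registered stub of the line's skeleton; `Z_H = pathKernel H x`, the
fugacity-`x` self-avoiding path kernel). Proof (the *pendant trick*): hang the two pendant edges `w q₁`,
`w q₂` on `H`, obtaining `G = H ⊔ edge w q₁ ⊔ edge w q₂ ≤ zdGraph 2`. In `G` the leaves `q₁`, `q₂` have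
`w` as their only neighbour, so every path from `q₁` and every path from `q₂` passes through `w`: the
quadruple `(q₁, q₂, p, q)` is interlaced, and `InterlacedTP2At x` gives
`Z_G(q₁,p) Z_G(q₂,q) ≤ Z_G(q₁,q₂) Z_G(p,q)`. Finally `Z_G(q₁,q₂) = x²` (the only path is `q₁ w q₂`),
`Z_G(q₁,p) ≥ x Z_H(w,p)` and `Z_G(q₂,q) ≥ x Z_H(w,q)` (prepend the pendant edge to a path of `H`), and
`Z_G(p,q) ≤ Z_H(p,q)` (a self-avoiding path between non-leaves never visits a leaf, hence uses only edges
of `H`); cancelling `x² > 0` gives the claim. Everything here is proved; Mathlib and the `Defs` module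
only. [folklore]
-/

noncomputable section

namespace Summit.CriticalPhenomena.SAWScalingLimit.Theorems.BoundaryTP2

open Literature.Probability.LatticeModels
open scoped ENNReal

variable {V : Type*}

/-! ## Walks at a pendant vertex -/

/-- If `ℓ` is a pendant vertex whose only neighbour is `c`, a walk starting at `ℓ` that does not visit
`c` is trivial. [folklore] -/
private theorem eq_of_walk_from_leaf {G : SimpleGraph V} {ℓ c : V}
    (hleaf : ∀ z, G.Adj ℓ z → z = c) {v : V} (δ : G.Walk ℓ v) (hc : c ∉ δ.support) : ℓ = v := by
  cases δ with
  | nil => rfl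
  | cons h δ' =>
    rw [SimpleGraph.Walk.support_cons, List.mem_cons, not_or] at hc
    obtain rfl := hleaf _ h
    exact absurd δ'.start_mem_support hc.2

/-- If `ℓ` is a pendant vertex whose only neighbour is `c`, every walk from `ℓ` to another vertex
visits `c`. [folklore] -/
private theorem mem_support_of_walk_from_leaf {G : SimpleGraph V} {ℓ c : V}
    (hleaf : ∀ z, G.Adj ℓ z → z = c) {v : V} (δ : G.Walk ℓ v) (hne : ℓ ≠ v) : c ∈ δ.support := by
  by_contra hc
  exact hne (eq_of_walk_from_leaf hleaf δ hc)

/-- A pendant vertex `ℓ` (only neighbour `c`) lying on a self-avoiding path is one of its endpoints: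
if it is not the final vertex, it is the initial one. [folklore] -/
private theorem leaf_eq_start_of_mem_support {G : SimpleGraph V} {ℓ c : V}
    (hleaf : ∀ z, G.Adj ℓ z → z = c) :
    ∀ {u v : V} (δ : G.Walk u v), δ.IsPath → ℓ ≠ v → ℓ ∈ δ.support → ℓ = u := by
  intro u v δ
  induction δ with
  | nil =>
    intro _ _ hmem
    rwa [SimpleGraph.Walk.support_nil, List.mem_singleton] at hmem
  | cons h δ' ih =>
    intro hpath hne hmem
    rw [SimpleGraph.Walk.cons_isPath_iff] at hpath
    rw [SimpleGraph.Walk.support_cons, List.mem_cons] at hmem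
    rcases hmem with hmem | hmem
    · exact hmem
    · obtain rfl := ih hpath.1 hne hmem
      obtain rfl := hleaf _ h.symm
      exact absurd (eq_of_walk_from_leaf hleaf δ' hpath.2) hne

/-- Between two distinct pendant vertices `q₁`, `q₂` hanging from the same vertex `c`, the only
self-avoiding path is `q₁ c q₂`. [folklore] -/
private theorem path_between_leaves_eq {G : SimpleGraph V} {q₁ q₂ c : V}
    (h₁ : ∀ z, G.Adj q₁ z → z = c) (h₂ : ∀ z, G.Adj q₂ z → z = c) (hq : q₁ ≠ q₂)
    (h₁c : G.Adj q₁ c) (hc₂ : G.Adj c q₂) (δ : G.Walk q₁ q₂) (hδ : δ.IsPath) :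
    δ = SimpleGraph.Walk.cons h₁c (SimpleGraph.Walk.cons hc₂ SimpleGraph.Walk.nil) := by
  cases δ with
  | nil => exact absurd rfl hq
  | cons h δ' =>
    obtain rfl := h₁ _ h
    rw [SimpleGraph.Walk.cons_isPath_iff] at hδ
    cases δ' with
    | nil => exact absurd rfl hc₂.ne
    | cons h' δ'' =>
      rw [SimpleGraph.Walk.cons_isPath_iff] at hδ
      obtain rfl := eq_of_walk_from_leaf h₂ δ''.reverse
        (by rw [SimpleGraph.Walk.support_reverse, List.mem_reverse]; exact hδ.1.2)
      obtain rfl := (SimpleGraph.Walk.isPath_iff_nil.1 hδ.1.1).eq_nil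
      rfl

/-- Every vertex of a walk of positive length is a non-isolated vertex of the graph. [folklore] -/
private theorem mem_graphSupport_of_mem_support {H : SimpleGraph V} :
    ∀ {u v : V} (γ : H.Walk u v), 0 < γ.length → ∀ {z : V}, z ∈ γ.support → z ∈ H.support := by
  intro u v γ
  induction γ with
  | nil => intro h; exact absurd h (lt_irrefl 0)
  | cons h γ' ih =>
    intro _ z hz
    rw [SimpleGraph.Walk.support_cons, List.mem_cons] at hz
    rcases hz with rfl | hz
    · exact h.mem_support_left
    · cases γ' with
      | nil =>
        rw [SimpleGraph.Walk.support_nil, List.mem_singleton] at hz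
        rw [hz]
        exact h.mem_support_right
      | cons h' γ'' =>
        exact ih (by rw [SimpleGraph.Walk.length_cons]; exact Nat.succ_pos _) hz

/-! ## Comparing path kernels along injections of paths -/

/-- Prepending an edge `ℓ ∼ a` of a supergraph `G ≥ H` to the self-avoiding paths `a → b` of `H`, none of
which visits `ℓ`, is an injection into the self-avoiding paths `ℓ → b` of `G`; hence
`x · Z_H(a,b) ≤ Z_G(ℓ,b)` for `x ≥ 0`. [folklore] -/
private theorem ofReal_mul_pathKernel_le {H G : SimpleGraph V} (hle : H ≤ G) (x : ℝ) (hx : 0 ≤ x)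
    {ℓ a b : V} (hadj : G.Adj ℓ a) (hℓ : ∀ γ : H.Walk a b, ℓ ∉ γ.support) :
    ENNReal.ofReal x * pathKernel H x a b ≤ pathKernel G x ℓ b := by
  have hE : ∀ γ : H.Walk a b, ∀ e, e ∈ γ.edges → e ∈ G.edgeSet := fun γ e he =>
    SimpleGraph.edgeSet_mono hle (γ.edges_subset_edgeSet he)
  let f : H.Path a b → G.Path ℓ b := fun γ =>
    ⟨SimpleGraph.Walk.cons hadj (γ.1.transfer G (hE γ.1)),
      (SimpleGraph.Walk.cons_isPath_iff hadj _).2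
        ⟨γ.2.transfer _, by rw [SimpleGraph.Walk.support_transfer]; exact hℓ γ.1⟩⟩
  have hf : Function.Injective f := by
    intro γ γ' h
    have h1 : (SimpleGraph.Walk.cons hadj (γ.1.transfer G (hE γ.1))).support =
        (SimpleGraph.Walk.cons hadj (γ'.1.transfer G (hE γ'.1))).support :=
      congrArg (fun δ : G.Path ℓ b => δ.1.support) h
    rw [SimpleGraph.Walk.support_cons, SimpleGraph.Walk.support_cons, SimpleGraph.Walk.support_transfer,
      SimpleGraph.Walk.support_transfer, List.cons.injEq] at h1
    exact Subtype.ext (SimpleGraph.Walk.ext_support h1.2)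
  calc ENNReal.ofReal x * pathKernel H x a b
      = ∑' γ : H.Path a b, ENNReal.ofReal x * ENNReal.ofReal (x ^ γ.1.length) := by
        rw [pathKernel, ENNReal.tsum_mul_left]
    _ = ∑' γ : H.Path a b, ENNReal.ofReal (x ^ (f γ).1.length) := by
        refine tsum_congr fun γ => ?_
        show ENNReal.ofReal x * ENNReal.ofReal (x ^ γ.1.length) =
          ENNReal.ofReal (x ^ (SimpleGraph.Walk.cons hadj (γ.1.transfer G (hE γ.1))).length)
        rw [SimpleGraph.Walk.length_cons, SimpleGraph.Walk.length_transfer, pow_succ',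
          ENNReal.ofReal_mul hx]
    _ ≤ ∑' δ : G.Path ℓ b, ENNReal.ofReal (x ^ δ.1.length) :=
        ENNReal.tsum_comp_le_tsum_of_injective hf (fun δ : G.Path ℓ b => ENNReal.ofReal (x ^ δ.1.length))
    _ = pathKernel G x ℓ b := rfl

/-- If every self-avoiding path `a → b` of `G` only uses edges of `H`, then `Z_G(a,b) ≤ Z_H(a,b)`:
transferring the paths to `H` is a length-preserving injection. [folklore] -/
private theorem pathKernel_le_of_edges {G H : SimpleGraph V} (x : ℝ) {a b : V}
    (hE : ∀ δ : G.Path a b, ∀ e, e ∈ δ.1.edges → e ∈ H.edgeSet) :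
    pathKernel G x a b ≤ pathKernel H x a b := by
  let g : G.Path a b → H.Path a b := fun δ => ⟨δ.1.transfer H (hE δ), δ.2.transfer _⟩
  have hg : Function.Injective g := by
    intro δ δ' h
    have h1 : (δ.1.transfer H (hE δ)).support = (δ'.1.transfer H (hE δ')).support :=
      congrArg (fun γ : H.Path a b => γ.1.support) h
    rw [SimpleGraph.Walk.support_transfer, SimpleGraph.Walk.support_transfer] at h1
    exact Subtype.ext (SimpleGraph.Walk.ext_support h1)
  calc pathKernel G x a b
      = ∑' δ : G.Path a b, ENNReal.ofReal (x ^ (g δ).1.length) := by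
        refine tsum_congr fun δ => ?_
        rw [show (g δ).1.length = δ.1.length from SimpleGraph.Walk.length_transfer _ _]
    _ ≤ ∑' γ : H.Path a b, ENNReal.ofReal (x ^ γ.1.length) :=
        ENNReal.tsum_comp_le_tsum_of_injective hg (fun γ : H.Path a b => ENNReal.ofReal (x ^ γ.1.length))
    _ = pathKernel H x a b := rfl

/-- A walk of a subgraph of `H ⊔ edge w q₁ ⊔ edge w q₂` that visits neither `q₁` nor `q₂` only uses
edges of `H`. [folklore] -/
private theorem edges_mem_of_notMem {H G : SimpleGraph V} {w q₁ q₂ u v : V}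
    (hG : G ≤ H ⊔ SimpleGraph.edge w q₁ ⊔ SimpleGraph.edge w q₂) (δ : G.Walk u v)
    (h₁ : q₁ ∉ δ.support) (h₂ : q₂ ∉ δ.support) : ∀ e, e ∈ δ.edges → e ∈ H.edgeSet := by
  intro e he
  have hG' := SimpleGraph.edgeSet_mono hG (δ.edges_subset_edgeSet he)
  rw [SimpleGraph.edgeSet_sup, SimpleGraph.edgeSet_sup, Set.mem_union, Set.mem_union] at hG'
  rcases hG' with (hG' | hG') | hG'
  · exact hG'
  · obtain rfl : e = s(w, q₁) := Set.mem_singleton_iff.1 (SimpleGraph.edgeSet_edge_subset hG')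
    exact absurd (δ.snd_mem_support_of_mem_edges he) h₁
  · obtain rfl : e = s(w, q₂) := Set.mem_singleton_iff.1 (SimpleGraph.edgeSet_edge_subset hG')
    exact absurd (δ.snd_mem_support_of_mem_edges he) h₂

/-! ## The pendant trick -/

/-- **Three-point splitting from interlacing-only TP₂ (the pendant trick).** Assume `InterlacedTP2At x`
for some `x > 0`. Let `H ≤ zdGraph 2` have finitely many non-isolated vertices, and let `w ∈ H.support`
have two lattice neighbours `q₁ ≠ q₂` that are isolated in `H`. Then for all distinct
`p, q ∈ H.support ∖ {w}`,

  `Z_H(w,p) · Z_H(w,q) ≤ Z_H(p,q)`.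

Proof: in `G = H ⊔ edge w q₁ ⊔ edge w q₂ ≤ zdGraph 2` the quadruple `(q₁, q₂, p, q)` is interlaced at `w`
(the leaves `q₁`, `q₂` have `w` as only neighbour), so `Z_G(q₁,p) Z_G(q₂,q) ≤ Z_G(q₁,q₂) Z_G(p,q)`;
moreover `Z_G(q₁,q₂) = x²`, `Z_G(q₁,p) ≥ x Z_H(w,p)`, `Z_G(q₂,q) ≥ x Z_H(w,q)`, `Z_G(p,q) ≤ Z_H(p,q)`, and
`x² > 0` cancels. Registered stub `stub_pendant_threePoint` of the line `Sketch`. [folklore] -/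
theorem stub_pendant_threePoint (x : ℝ) (hx : 0 < x) (h : InterlacedTP2At x) (H : SimpleGraph (Site 2))
    (hH : H ≤ zdGraph 2) (hfin : H.support.Finite) (w q₁ q₂ p q : Site 2)
    (hq₁ : (zdGraph 2).Adj w q₁) (hq₂ : (zdGraph 2).Adj w q₂) (hq : q₁ ≠ q₂)
    (hq₁H : q₁ ∉ H.support) (hq₂H : q₂ ∉ H.support) (hw : w ∈ H.support) (hp : p ∈ H.support)
    (hqH : q ∈ H.support) (hwp : w ≠ p) (hwq : w ≠ q) (hpq : p ≠ q) :
    pathKernel H x w p * pathKernel H x w q ≤ pathKernel H x p q := by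
  -- members and non-members of `H.support` are distinct
  have hne : ∀ {a b : Site 2}, a ∈ H.support → b ∉ H.support → a ≠ b :=
    fun ha hb hab => hb (hab ▸ ha)
  -- the enlarged graph `G`: hang the pendant edges `w q₁`, `w q₂` on `H`
  obtain ⟨G, hG⟩ :
      ∃ G : SimpleGraph (Site 2), G = H ⊔ SimpleGraph.edge w q₁ ⊔ SimpleGraph.edge w q₂ := ⟨_, rfl⟩
  have hGadj : ∀ a b : Site 2, G.Adj a b ↔
      (H.Adj a b ∨ (a = w ∧ b = q₁ ∨ a = q₁ ∧ b = w) ∧ a ≠ b) ∨ (a = w ∧ b = q₂ ∨ a = q₂ ∧ b = w) ∧ a ≠ b :=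
    fun a b => by rw [hG, SimpleGraph.sup_adj, SimpleGraph.sup_adj, SimpleGraph.edge_adj, SimpleGraph.edge_adj]
  have hle : H ≤ G := by rw [hG]; exact le_sup_left.trans le_sup_left
  have hGzd : G ≤ zdGraph 2 := by
    rw [hG]
    exact sup_le (sup_le hH ((SimpleGraph.edge_le_iff _).2 (Or.inr hq₁)))
      ((SimpleGraph.edge_le_iff _).2 (Or.inr hq₂))
  have hq₁w : G.Adj q₁ w := (hGadj q₁ w).2 (Or.inl (Or.inr ⟨Or.inr ⟨rfl, rfl⟩, (hne hw hq₁H).symm⟩))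
  have hwq₂ : G.Adj w q₂ := (hGadj w q₂).2 (Or.inr ⟨Or.inl ⟨rfl, rfl⟩, hne hw hq₂H⟩)
  -- in `G`, the leaves `q₁`, `q₂` have `w` as their only neighbour
  have hleaf₁ : ∀ z, G.Adj q₁ z → z = w := by
    intro z hz
    rcases (hGadj q₁ z).1 hz with (hz | ⟨⟨h1, h2⟩ | ⟨-, h2⟩, -⟩) | ⟨⟨h1, -⟩ | ⟨h1, -⟩, -⟩
    · exact (hq₁H hz.mem_support_left).elim
    · exact h2.trans h1
    · exact h2
    · exact (hne hw hq₁H h1.symm).elim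
    · exact (hq h1).elim
  have hleaf₂ : ∀ z, G.Adj q₂ z → z = w := by
    intro z hz
    rcases (hGadj q₂ z).1 hz with (hz | ⟨⟨h1, -⟩ | ⟨h1, -⟩, -⟩) | ⟨⟨h1, h2⟩ | ⟨-, h2⟩, -⟩
    · exact (hq₂H hz.mem_support_left).elim
    · exact (hne hw hq₂H h1.symm).elim
    · exact (hq h1.symm).elim
    · exact h2.trans h1
    · exact h2
  -- `G ≤ zdGraph 2` has finitely many non-isolated vertices
  have hsupp : G.support ⊆ H.support ∪ {w, q₁, q₂} := by
    intro v hv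
    obtain ⟨z, hz⟩ := (SimpleGraph.mem_support G).1 hv
    simp only [Set.mem_union, Set.mem_insert_iff, Set.mem_singleton_iff]
    rcases (hGadj v z).1 hz with (hz | ⟨⟨h1, -⟩ | ⟨h1, -⟩, -⟩) | ⟨⟨h1, -⟩ | ⟨h1, -⟩, -⟩
    · exact Or.inl hz.mem_support_left
    · exact Or.inr (Or.inl h1)
    · exact Or.inr (Or.inr (Or.inl h1))
    · exact Or.inr (Or.inl h1)
    · exact Or.inr (Or.inr (Or.inr h1))
  have hfinG : G.support.Finite :=
    (hfin.union (((Set.finite_singleton q₂).insert q₁).insert w)).subset hsupp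
  -- the quadruple `(q₁, q₂, p, q)` is interlaced in `G` (at `w`), so `InterlacedTP2At x` applies
  have hint : Interlaced G q₁ q₂ p q := fun P Q =>
    ⟨w, mem_support_of_walk_from_leaf hleaf₁ P.1 (hne hp hq₁H).symm,
      mem_support_of_walk_from_leaf hleaf₂ Q.1 (hne hqH hq₂H).symm⟩
  have key : pathKernel G x q₁ p * pathKernel G x q₂ q ≤ pathKernel G x q₁ q₂ * pathKernel G x p q :=
    h G hGzd hfinG q₁ q₂ p q hq (hne hp hq₁H).symm (hne hqH hq₁H).symm (hne hp hq₂H).symm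
      (hne hqH hq₂H).symm hpq hint
  -- `x · Z_H(w,p) ≤ Z_G(q₁,p)` and `x · Z_H(w,q) ≤ Z_G(q₂,q)`
  have hA : ENNReal.ofReal x * pathKernel H x w p ≤ pathKernel G x q₁ p :=
    ofReal_mul_pathKernel_le hle x hx.le hq₁w fun γ hmem => hq₁H
      (mem_graphSupport_of_mem_support γ
        (Nat.pos_of_ne_zero fun h0 => hwp (SimpleGraph.Walk.eq_of_length_eq_zero h0)) hmem)
  have hA' : ENNReal.ofReal x * pathKernel H x w q ≤ pathKernel G x q₂ q :=
    ofReal_mul_pathKernel_le hle x hx.le hwq₂.symm fun γ hmem => hq₂H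
      (mem_graphSupport_of_mem_support γ
        (Nat.pos_of_ne_zero fun h0 => hwq (SimpleGraph.Walk.eq_of_length_eq_zero h0)) hmem)
  -- `Z_G(q₁,q₂) = x²`: the only self-avoiding path is `q₁ w q₂`
  have hB : pathKernel G x q₁ q₂ ≤ ENNReal.ofReal x * ENNReal.ofReal x := by
    have hP₀ : (SimpleGraph.Walk.cons hq₁w (SimpleGraph.Walk.cons hwq₂ SimpleGraph.Walk.nil)).IsPath := by
      refine (SimpleGraph.Walk.cons_isPath_iff _ _).2 ⟨(SimpleGraph.Walk.cons_isPath_iff _ _).2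
        ⟨SimpleGraph.Walk.IsPath.nil, fun h' => hne hw hq₂H ?_⟩, fun h' => ?_⟩
      · rwa [SimpleGraph.Walk.support_nil, List.mem_singleton] at h'
      · rw [SimpleGraph.Walk.support_cons, SimpleGraph.Walk.support_nil, List.mem_cons,
          List.mem_singleton] at h'
        exact h'.elim (fun h' => hne hw hq₁H h'.symm) fun h' => hq h'
    have huniq : ∀ δ : G.Path q₁ q₂, δ = ⟨_, hP₀⟩ := fun δ =>
      Subtype.ext (path_between_leaves_eq hleaf₁ hleaf₂ hq hq₁w hwq₂ δ.1 δ.2)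
    rw [pathKernel, tsum_eq_single _ fun δ hδ => absurd (huniq δ) hδ]
    show ENNReal.ofReal (x ^ 2) ≤ ENNReal.ofReal x * ENNReal.ofReal x
    rw [pow_two, ENNReal.ofReal_mul hx.le]
  -- `Z_G(p,q) ≤ Z_H(p,q)`: a self-avoiding path `p → q` of `G` avoids the leaves, hence lies in `H`
  have hC : pathKernel G x p q ≤ pathKernel H x p q :=
    pathKernel_le_of_edges x fun δ => edges_mem_of_notMem hG.le δ.1
      (fun hm => hne hp hq₁H (leaf_eq_start_of_mem_support hleaf₁ δ.1 δ.2 (hne hqH hq₁H).symm hm).symm)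
      (fun hm => hne hp hq₂H (leaf_eq_start_of_mem_support hleaf₂ δ.1 δ.2 (hne hqH hq₂H).symm hm).symm)
  -- assemble and cancel `x² > 0`
  have hx0 : ENNReal.ofReal x * ENNReal.ofReal x ≠ 0 :=
    mul_ne_zero (ENNReal.ofReal_pos.2 hx).ne' (ENNReal.ofReal_pos.2 hx).ne'
  have hxtop : ENNReal.ofReal x * ENNReal.ofReal x ≠ ∞ :=
    ENNReal.mul_ne_top ENNReal.ofReal_ne_top ENNReal.ofReal_ne_top
  rw [← ENNReal.mul_le_mul_iff_right hx0 hxtop]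
  calc ENNReal.ofReal x * ENNReal.ofReal x * (pathKernel H x w p * pathKernel H x w q)
      = ENNReal.ofReal x * pathKernel H x w p * (ENNReal.ofReal x * pathKernel H x w q) :=
        mul_mul_mul_comm _ _ _ _
    _ ≤ pathKernel G x q₁ p * pathKernel G x q₂ q := mul_le_mul' hA hA'
    _ ≤ pathKernel G x q₁ q₂ * pathKernel G x p q := key
    _ ≤ ENNReal.ofReal x * ENNReal.ofReal x * pathKernel H x p q := mul_le_mul' hB hC

end Summit.CriticalPhenomena.SAWScalingLimit.Theorems.BoundaryTP2
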